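import Mathlib
import HarnessLib.Audit
import Summits.PneNP.PneNP.Theorems.PstarChordBridgeFive
import Summits.PneNP.PneNP.Theorems.PstarChordBridgeCentre

/-!
# The two standing assumptions of the core bound, as typed targets (ROUND-24, memo §9 O1/O2, §14; GAPTWO-PLAN S4)

FRONTIER range-avoidance ladder, rung F-N3, ROUND 24 (cell `pnp-ideate`, planner memo `r24/CORE-BOUND-NOTES.md` §9 (R-chain, O1/O2), §13.2
(max-sharing regime), §14 (this file); restricted-model proof complexity of the pure typed XOR-AND local maps `P⋆` — nothing here bears on `P`
versus `NP`).

STATE OF THE CHAIN.  `PstarChordBridgeFive.card_le_five_of_terminal` (prover-2, p642886) bounds every TERMINAL core — a non-empty XOR-closed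
`J₀` with `#J₀ < r`, two G-constraints `w₁, w₂` with monomial outputs off `J₀` inside the radius, (T3) jointly unsolvable, (M0) solvable after
deleting any output of `J₀` — by FIVE outputs, under two standing assumptions:
* (O1, ASSUMPTION A) a maximal leaf-peelable `F ⊆ J₀` all of whose co-edges are chords — automatic for `#J₀ < 12`
  (`PstarChordBridgeCentre.assumptionA_of_card_lt`), genuinely open from twelve outputs on (centre cycles, memo §7 G1);
* (O2, PRIVATES UNREAD) no monomial output of `w₁, w₂` touches an AND-private variable of a co-edge of `F` (hypothesis `hun`) — the gate readers
  `(p_e, z)` of memo §10.1 are excluded by it; the kit censuses K18/K19 (`k ≤ 8` complete but for the last no-sharing structures, `k = 9` partial)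
  find no gated core beyond the `k = 1` gate (`#J₀ = 3`), and `PstarGateUnitBridge.gate_unit_of_dir` (p646443) settles the direction-pin gate.

THIS FILE types the targets that remove them, so that provers close them BY NAME:
* `Terminal I r y J₀ w₁ w₂` — the terminal-core hypotheses of `card_le_five_of_terminal`, bundled;
* `TerminalFive` (conjecture C5 of the memo, the TARGET): every terminal core of a pure typed `(r,3/2)`-expanding instance with simple overlaps
  has at most five outputs — no Assumption A, no privates-unread;
* `TerminalFiveA` (= O2 ALONE): the same for terminal cores carrying a maximal leaf-peelable `F` with chord co-edges (Assumption A kept,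
  privates-unread dropped) — the CHAMBER-COHERENCE crux (prover-1 `O2-SCOPING.md` T-O2-4; prover-2 `O1-SCOPING.md` §6);
* `TerminalPeelable` (= O1 ALONE): the non-chords of a terminal core are leaf-peelable (no centre cycle) — prover-2 `O1-SCOPING.md` S-O1a/b/c;
* `TerminalFiveMaxSharing` — the first rung of both: terminal cores at MAXIMAL sharing `2·#sharedSlots = #J₀` (memo §13.2; the tight twelve-output
  centre structure S-O1a lives here) have at most five outputs;
* glue (all proved here, a few lines each): `terminalFive_of_pieces : TerminalPeelable → TerminalFiveA → TerminalFive` (via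
  `exists_maximal_peelable_sup`) and the converses `terminalFiveA_of_terminalFive`, `terminalPeelable_of_terminalFive` (the latter through the
  landed twelve-output threshold); `card_le_five_of_terminal'` restates the landed theorem through `Terminal` (`TerminalFiveA` plus `hun` IS a
  theorem); `card_le_five_of_lt_twelve : TerminalFiveA → (terminal ∧ #J₀ < 12 ⇒ #J₀ ≤ 5)` (O2 alone settles every core of at most eleven
  outputs); `terminalFiveMaxSharing_of_terminalFive`; and downstream `coreBoundAt_of_terminalFive : TerminalFive → CoreBoundAt I y J 5` (`#J < r`) and
  `card_le_of_terminalFive : TerminalFive → #J ≤ 8Δ² + 5(4Δ + 1)` for minimal infeasible `J` under at most two parity constraints with `#J < r`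
  — the `h = 2` rung with an absolute core constant (the edge `#J = r` of `PstarGapTwo.GapTwo` is the upstream `< r / ≤ r` bookkeeping noted by
  prover-2, not part of these targets).

Nothing in this file is claimed beyond the glue: `TerminalFive`, `TerminalFiveA`, `TerminalPeelable`, `TerminalFiveMaxSharing` are OPEN
(`@[conjecture]`); the kit evidence (memo §13.4, K18/K19: ≈2·10¹⁰ admissible candidates, cores only CONS-T (3) and CONS-P3 (5) for `k ≤ 8`)
supports `TerminalFive` in exactly this hypothesis set (T3 + M0 + admissibility; no pendant minimality is used).
-/

set_option linter.dupNamespace false -- `Summit.PneNP.PneNP.…`: summit = sub-problem name (D-0017 single-conjunct layout)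

open Finset Module Literature.Computability.Complexity
open Summit.PneNP.PneNP.Theorems.PstarTyped (Typed)
open Summit.PneNP.PneNP.Theorems.PstarSALevel (varSet bdry BoundaryExpanding SimpleOverlap)
open Summit.PneNP.PneNP.Theorems.PstarGapLemma (MinInfeasible MaxDegree)
open Summit.PneNP.PneNP.Theorems.PstarGapOneAll (gval)
open Summit.PneNP.PneNP.Theorems.PstarCoreBound (XorClosed)
open Summit.PneNP.PneNP.Theorems.PstarChordRepair (IsChord)
open Summit.PneNP.PneNP.Theorems.PstarGapTwoAssembly (CoreBoundAt card_le_of_coreBoundAt)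
open Summit.PneNP.PneNP.Theorems.PstarChordBridgeTools
open Summit.PneNP.PneNP.Theorems.PstarChordBridge
open Summit.PneNP.PneNP.Theorems.PstarChordBridgeCotree (Peelable)
open Summit.PneNP.PneNP.Theorems.PstarChordBridgeTerminal (Represents exists_pair sat_pair_iff)
open Summit.PneNP.PneNP.Theorems.PstarChordBridgeFive (card_le_five_of_terminal)
open Summit.PneNP.PneNP.Theorems.PstarChordBridgeCentre (exists_maximal_peelable_sup assumptionA_of_card_lt)
open Summit.PneNP.PneNP.Theorems.PstarSharingBound (sharedSlots)

namespace Summit.PneNP.PneNP.Theorems.PstarCoreBoundTargets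

variable {n m : ℕ}

/-! ## Terminal cores -/

/-- **The terminal-core hypotheses** of `PstarChordBridgeFive.card_le_five_of_terminal`, bundled: `J₀` non-empty, XOR-closed, `#J₀ < r`;
two G-constraints `w₁, w₂ = (Cᵢ, Gᵢ, bᵢ)` ("`Σ_{v∈Cᵢ} z_v + Σ_{g∈Gᵢ} z_{p_g} z_{q_g} = bᵢ`") with monomial outputs `Gᵢ` off `J₀` and
`#(J₀ ∪ G₁ ∪ G₂) ≤ r`; (T3) `J₀ ∧ w₁ ∧ w₂` unsolvable over the fibre values `y`; (M0) solvable after deleting any one output of `J₀`. -/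
def Terminal (I : LocalMap 4 n m) (r : ℕ) (y : Fin m → Bool) (J₀ : Finset (Fin m)) (w₁ w₂ : Finset (Fin n) × Finset (Fin m) × Bool) :
    Prop :=
  J₀.Nonempty ∧ XorClosed I J₀ ∧ J₀.card < r ∧ Disjoint J₀ w₁.2.1 ∧ Disjoint J₀ w₂.2.1 ∧ (J₀ ∪ w₁.2.1 ∪ w₂.2.1).card ≤ r ∧
  (¬ ∃ z : Fin n → Bool, (∀ j ∈ J₀, I.eval z j = y j) ∧ gval I w₁.1 w₁.2.1 z = w₁.2.2 ∧ gval I w₂.1 w₂.2.1 z = w₂.2.2) ∧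
  (∀ f ∈ J₀, ∃ z : Fin n → Bool, (∀ j ∈ J₀.erase f, I.eval z j = y j) ∧ gval I w₁.1 w₁.2.1 z = w₁.2.2 ∧ gval I w₂.1 w₂.2.1 z = w₂.2.2)

/-- The NON-CHORDS of `J₀`: outputs with an AND variable shared inside `J₀` (the memo's centre edges). -/
def nonchords (I : LocalMap 4 n m) (J₀ : Finset (Fin m)) : Finset (Fin m) :=
  J₀.filter fun f => I.vars f 2 ∉ bdry I J₀ ∨ I.vars f 3 ∉ bdry I J₀

/-- Non-chords are outputs of `J₀`. -/
theorem nonchords_subset (I : LocalMap 4 n m) (J₀ : Finset (Fin m)) : nonchords I J₀ ⊆ J₀ := filter_subset _ _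

/-- Membership in `nonchords`: an output of `J₀` that is not a chord of `J₀`. -/
theorem mem_nonchords (I : LocalMap 4 n m) {J₀ : Finset (Fin m)} {f : Fin m} :
    f ∈ nonchords I J₀ ↔ f ∈ J₀ ∧ ¬ IsChord I J₀ f := by
  unfold nonchords PstarChordRepair.IsChord
  rw [mem_filter, not_and_or]

/-! ## The targets -/

/-- **TARGET (memo C5; OPEN): every terminal core has at most five outputs.**  Pure typed `(r,3/2)`-expanding instance with simple overlaps;
no Assumption A, no privates-unread.  Equivalent, given the landed chain, to `TerminalPeelable ∧ TerminalFiveA` (`terminalFive_of_pieces` and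
the trivial converses).  FRONTIER. -/
@[conjecture] def TerminalFive : Prop :=
  ∀ (n m r : ℕ) (I : LocalMap 4 n m), I.IsPure xorAndPred → Typed I → SimpleOverlap I → BoundaryExpanding r I →
    ∀ (y : Fin m → Bool) (J₀ : Finset (Fin m)) (w₁ w₂ : Finset (Fin n) × Finset (Fin m) × Bool), Terminal I r y J₀ w₁ w₂ → J₀.card ≤ 5

/-- **O2 ALONE (OPEN): `card_le_five_of_terminal` without privates-unread.**  A terminal core with a maximal leaf-peelable `F ⊆ J₀` whose
co-edges are chords has at most five outputs — the monomial outputs of `w₁, w₂` MAY read the AND-privates of the chords (gates `(p_e, z)`,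
CROSS readers `(p_e, p_e')`).  The crux is CHAMBER COHERENCE (prover-1 `O2-SCOPING.md` §4, T-O2-4): per chord, the landed fibre/pointwise
theorems give the classification in the chord's own minimality chamber; the global count compares chords whose chambers may differ.
With `hun` added this is the theorem `card_le_five_of_terminal'` below.  FRONTIER. -/
@[conjecture] def TerminalFiveA : Prop :=
  ∀ (n m r : ℕ) (I : LocalMap 4 n m), I.IsPure xorAndPred → Typed I → SimpleOverlap I → BoundaryExpanding r I →
    ∀ (y : Fin m → Bool) (J₀ : Finset (Fin m)) (w₁ w₂ : Finset (Fin n) × Finset (Fin m) × Bool), Terminal I r y J₀ w₁ w₂ →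
    ∀ F ⊆ J₀, Peelable I F → (∀ F', F ⊆ F' → F' ⊆ J₀ → Peelable I F' → F' = F) → (∀ e ∈ J₀ \ F, IsChord I J₀ e) → J₀.card ≤ 5

/-- **O1 ALONE (OPEN): terminal cores have no centre cycle** — the non-chords of a terminal core are leaf-peelable (XOR-acyclic), so that
Assumption A holds (`exists_maximal_peelable_sup`).  By `PstarChordBridgeCentre.twelve_le_of_leafless_nonchords` the first case is `#J₀ = 12`
at maximal sharing (an XOR triangle of non-chords, each sharing one AND variable with a chord outside it; prover-2 `O1-SCOPING.md` S-O1a);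
the proposed route is the half-chord bridge S-O1b + variety rigidity S-O1c.  FRONTIER. -/
@[conjecture] def TerminalPeelable : Prop :=
  ∀ (n m r : ℕ) (I : LocalMap 4 n m), I.IsPure xorAndPred → Typed I → SimpleOverlap I → BoundaryExpanding r I →
    ∀ (y : Fin m → Bool) (J₀ : Finset (Fin m)) (w₁ w₂ : Finset (Fin n) × Finset (Fin m) × Bool), Terminal I r y J₀ w₁ w₂ →
    Peelable I (nonchords I J₀)

/-- **FIRST RUNG OF BOTH (OPEN): terminal cores at maximal sharing have at most five outputs.**  `2·#sharedSlots = #J₀` is the extreme case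
of the sharing bound R0 (`PstarSharingBound.two_mul_card_sharedSlots_le`); memo §13.2: here every output has exactly one shared and one private
AND slot, the instance is a disjoint union of "literal stars", and the tight twelve-output centre structure of O1 is of this kind.  FRONTIER. -/
@[conjecture] def TerminalFiveMaxSharing : Prop :=
  ∀ (n m r : ℕ) (I : LocalMap 4 n m), I.IsPure xorAndPred → Typed I → SimpleOverlap I → BoundaryExpanding r I →
    ∀ (y : Fin m → Bool) (J₀ : Finset (Fin m)) (w₁ w₂ : Finset (Fin n) × Finset (Fin m) × Bool), Terminal I r y J₀ w₁ w₂ →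
    2 * (sharedSlots I J₀).card = J₀.card → J₀.card ≤ 5

/-! ## What is landed, restated through `Terminal` -/

/-- **`TerminalFiveA` with privates-unread is a theorem** (`PstarChordBridgeFive.card_le_five_of_terminal`, restated). -/
theorem card_le_five_of_terminal' (I : LocalMap 4 n m) (hI : I.IsPure xorAndPred) (hT : Typed I) (hS : SimpleOverlap I) {r : ℕ}
    (hB : BoundaryExpanding r I) (y : Fin m → Bool) {J₀ : Finset (Fin m)} {w₁ w₂ : Finset (Fin n) × Finset (Fin m) × Bool}
    (h : Terminal I r y J₀ w₁ w₂) {F : Finset (Fin m)} (hF : F ⊆ J₀) (hP : Peelable I F)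
    (hmax : ∀ F', F ⊆ F' → F' ⊆ J₀ → Peelable I F' → F' = F) (hchord : ∀ e ∈ J₀ \ F, IsChord I J₀ e)
    (hun : ∀ g ∈ w₁.2.1 ∪ w₂.2.1, ∀ v ∈ privs I (J₀ \ F), I.vars g 2 ≠ v ∧ I.vars g 3 ≠ v) : J₀.card ≤ 5 := by
  obtain ⟨hne, hX, hJr, hG₁, hG₂, hr, hT3, hM0⟩ := h
  exact card_le_five_of_terminal I hI hT hS hB y hne hX hJr w₁ w₂ hG₁ hG₂ hr hT3 hM0 hF hP hmax hchord hun

/-- **Assumption A is automatic below twelve outputs** (`PstarChordBridgeCentre.assumptionA_of_card_lt`, restated for terminal cores). -/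
theorem assumptionA_of_terminal_lt_twelve (I : LocalMap 4 n m) (hI : I.IsPure xorAndPred) (hT : Typed I) (hS : SimpleOverlap I) {r : ℕ}
    (hB : BoundaryExpanding r I) {y : Fin m → Bool} {J₀ : Finset (Fin m)} {w₁ w₂ : Finset (Fin n) × Finset (Fin m) × Bool}
    (h : Terminal I r y J₀ w₁ w₂) (hk : J₀.card < 12) :
    ∃ F ⊆ J₀, Peelable I F ∧ (∀ F', F ⊆ F' → F' ⊆ J₀ → Peelable I F' → F' = F) ∧ ∀ e ∈ J₀ \ F, IsChord I J₀ e :=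
  assumptionA_of_card_lt I hI hT hS hB h.2.1 h.2.2.1.le hk

/-! ## Glue -/

/-- **O1 and O2 together give the target.** -/
theorem terminalFive_of_pieces (h₁ : TerminalPeelable) (h₂ : TerminalFiveA) : TerminalFive := by
  intro n m r I hI hT hS hB y J₀ w₁ w₂ h
  classical
  obtain ⟨F, hS₀F, hFJ, hPF, hmax⟩ :=
    exists_maximal_peelable_sup I (nonchords_subset I J₀) (h₁ n m r I hI hT hS hB y J₀ w₁ w₂ h)
  refine h₂ n m r I hI hT hS hB y J₀ w₁ w₂ h F hFJ hPF hmax fun e he => ?_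
  rw [mem_sdiff] at he
  by_contra hc
  exact he.2 (hS₀F ((mem_nonchords I).2 ⟨he.1, hc⟩))

/-- The target trivially gives O2 alone. -/
theorem terminalFiveA_of_terminalFive (h : TerminalFive) : TerminalFiveA :=
  fun n m r I hI hT hS hB y J₀ w₁ w₂ ht _ _ _ _ _ => h n m r I hI hT hS hB y J₀ w₁ w₂ ht

/-- The target trivially gives the max-sharing rung. -/
theorem terminalFiveMaxSharing_of_terminalFive (h : TerminalFive) : TerminalFiveMaxSharing :=
  fun n m r I hI hT hS hB y J₀ w₁ w₂ ht _ => h n m r I hI hT hS hB y J₀ w₁ w₂ ht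

/-- **O2 alone settles every terminal core of fewer than twelve outputs.** -/
theorem card_le_five_of_lt_twelve (h : TerminalFiveA) (I : LocalMap 4 n m) (hI : I.IsPure xorAndPred) (hT : Typed I)
    (hS : SimpleOverlap I) {r : ℕ} (hB : BoundaryExpanding r I) {y : Fin m → Bool} {J₀ : Finset (Fin m)}
    {w₁ w₂ : Finset (Fin n) × Finset (Fin m) × Bool} (ht : Terminal I r y J₀ w₁ w₂) (hk : J₀.card < 12) : J₀.card ≤ 5 := by
  obtain ⟨F, hF, hP, hmax, hchord⟩ := assumptionA_of_terminal_lt_twelve I hI hT hS hB ht hk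
  exact h n m r I hI hT hS hB y J₀ w₁ w₂ ht F hF hP hmax hchord

/-- **The target trivially gives O1 alone** modulo the landed threshold: a terminal core with a centre cycle has `≥ 12 > 5` outputs.
(`PstarChordBridgeCentre.peelable_nonchords_of_card_lt`.) -/
theorem terminalPeelable_of_terminalFive (h : TerminalFive) : TerminalPeelable := by
  intro n m r I hI hT hS hB y J₀ w₁ w₂ ht
  have h5 := h n m r I hI hT hS hB y J₀ w₁ w₂ ht
  exact PstarChordBridgeCentre.peelable_nonchords_of_card_lt I hI hT hS hB ht.2.1 ht.2.2.1.le (by omega)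

/-! ## Downstream: the strong-form core bound and the two-query bound from the target -/

/-- **The target in the finset-of-constraints vocabulary of `CoreBoundAt`** (`𝒲` with `#𝒲 ≤ 2`, monomials in `J ∖ J₀`, `J₀ ⊆ J`,
`#J ≤ r`, `#J₀ < r`). -/
theorem card_le_five_W (h : TerminalFive) (I : LocalMap 4 n m) (hI : I.IsPure xorAndPred) (hT : Typed I) (hS : SimpleOverlap I)
    {r : ℕ} (hB : BoundaryExpanding r I) (y : Fin m → Bool) {J J₀ : Finset (Fin m)} (hJ₀J : J₀ ⊆ J) (hJr : J.card ≤ r)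
    (hJ₀r : J₀.card < r) (hne : J₀.Nonempty) (hX : XorClosed I J₀) (𝒲 : Finset (Finset (Fin n) × Finset (Fin m) × Bool))
    (h𝒲 : 𝒲.card ≤ 2) (hmono : ∀ w ∈ 𝒲, w.2.1 ⊆ J \ J₀)
    (hT3 : ¬ ∃ z : Fin n → Bool, (∀ j ∈ J₀, I.eval z j = y j) ∧ ∀ w ∈ 𝒲, gval I w.1 w.2.1 z = w.2.2)
    (hM0 : ∀ f ∈ J₀, ∃ z : Fin n → Bool, (∀ j ∈ J₀.erase f, I.eval z j = y j) ∧ ∀ w ∈ 𝒲, gval I w.1 w.2.1 z = w.2.2) :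
    J₀.card ≤ 5 := by
  classical
  obtain ⟨w₁, w₂, hrep⟩ := exists_pair 𝒲 h𝒲
  have hsub : ∀ w, (w ∈ 𝒲 ∨ w = ((∅ : Finset (Fin n)), (∅ : Finset (Fin m)), false)) → w.2.1 ⊆ J \ J₀ := by
    rintro w (hw | rfl)
    · exact hmono w hw
    · exact fun g hg => absurd hg (notMem_empty g)
  have h₁ := hsub w₁ hrep.2.1
  have h₂ := hsub w₂ hrep.2.2
  have hdisj : ∀ w : Finset (Fin n) × Finset (Fin m) × Bool, w.2.1 ⊆ J \ J₀ → Disjoint J₀ w.2.1 :=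
    fun w hw => disjoint_left.2 fun j hj hj' => (mem_sdiff.1 (hw hj')).2 hj
  have hr : (J₀ ∪ w₁.2.1 ∪ w₂.2.1).card ≤ r :=
    (card_le_card (union_subset (union_subset hJ₀J (h₁.trans sdiff_subset)) (h₂.trans sdiff_subset))).trans hJr
  refine h n m r I hI hT hS hB y J₀ w₁ w₂ ⟨hne, hX, hJ₀r, hdisj w₁ h₁, hdisj w₂ h₂, hr, ?_, ?_⟩
  · rintro ⟨z, hz, hz₁, hz₂⟩
    exact hT3 ⟨z, hz, (sat_pair_iff I hrep z).2 ⟨hz₁, hz₂⟩⟩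
  · intro f hf
    obtain ⟨z, hz, hzW⟩ := hM0 f hf
    obtain ⟨hz₁, hz₂⟩ := (sat_pair_iff I hrep z).1 hzW
    exact ⟨z, hz, hz₁, hz₂⟩

/-- **`CoreBoundAt I y J 5` from the target**, for every output set `J` with `#J < r`. -/
theorem coreBoundAt_of_terminalFive (h : TerminalFive) (I : LocalMap 4 n m) (hI : I.IsPure xorAndPred) (hT : Typed I)
    (hS : SimpleOverlap I) {r : ℕ} (hB : BoundaryExpanding r I) (y : Fin m → Bool) {J : Finset (Fin m)} (hJr : J.card < r) :
    CoreBoundAt I y J 5 := by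
  intro J₀ 𝒲 hsub hne _ hcard hmono _ hX _ hT3 hM0 _
  exact card_le_five_W h I hI hT hS hB y hsub hJr.le (lt_of_le_of_lt (card_le_card hsub) hJr) hne hX 𝒲 hcard hmono hT3 hM0

/-- **The two-query bound from the target**: on a pure typed `(r,3/2)`-expanding instance with simple overlaps and variable degree `≤ Δ`, every
minimal infeasible output set `J` under at most two parity constraints with `#J < r` has `#J ≤ 8Δ² + 5(4Δ + 1)`. -/
theorem card_le_of_terminalFive (h : TerminalFive) {Δ r : ℕ} (I : LocalMap 4 n m) (hI : I.IsPure xorAndPred) (hT : Typed I)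
    (hS : SimpleOverlap I) (hB : BoundaryExpanding r I) (hD : MaxDegree Δ I) (y : Fin m → Bool) (W : Finset (Finset (Fin n) × Bool))
    (J : Finset (Fin m)) (hW : W.card ≤ 2) (hJr : J.card < r) (hmin : MinInfeasible I y W J) :
    J.card ≤ 8 * Δ ^ 2 + (4 * Δ + 1) * 5 :=
  card_le_of_coreBoundAt I hI hT hS hB hD y W J hW hJr.le hmin (coreBoundAt_of_terminalFive h I hI hT hS hB y hJr)

end Summit.PneNP.PneNP.Theorems.PstarCoreBoundTargets
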